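import Literature.RingTheory.MvPowerSeries.PartialDerivative
import Literature.RingTheory.MvPowerSeries.MaximalIdealPow
import HarnessLib

/-!
# [OURS · L1 W4.6, rungs (i)/(ii) — the dictionary, SCHEME HALF, brick 11] The Tjurina ideal is intrinsic:
# `T(w · θF) = θ(T(F))` for a unit `w` and a `κ`-algebra automorphism `θ` of `κ⟦X⟧`; hence finiteness of the Tjurina
# algebra does not depend on the formal coordinates

Cell res-hironaka (LADDER-RESOLUTION rung L, D-0089), slot W4.6, seat res-L1-s46-pv-2 (gen 2). Host: route
`WildCones`, crux `ClassicalRegimes` (stmt-ResolutionOfSingularities-16884), `--supports … --as helper`.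

HONEST FRAMING. Everything here is OURS and is elementary differential algebra of formal power series, using the
tree's partial derivatives `Literature.RingTheory.MvPowerSeries.pd` with their Leibniz and CHAIN rules (`pd_mul`,
`pd_subst`, `PartialDerivative.lean`) and «endomorphisms are substitutions» (`Jets.algHom_apply_eq_subst`,
`MaximalIdealPow.lean`). NOTHING here is a statement of H. Hironaka's manuscript [Hironaka2017]; no FACT-LIST premise.
AI review is weaker than expert review.

## Why (the forced-atom rung, plan K of this seat)

Along a run of the typed procedure the dictionary (bricks 1–10) produces, at the new singular point, the presentation
`E′(f′) = w′ · (z^p − ser (step i τ c))` of the transform, while the REGIME hypothesis at that point provides SOME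
presentation `E″(f′) = w″ · (z^p − ser c″)` with `Isol c″` (finite Tjurina algebra, brick 3 `isol_iff_finite_tjurina′`).
The two differ by the automorphism `θ = E′ ∘ E″⁻¹` of `κ⟦z,u⟧` and a unit; this file shows that finiteness of the
Tjurina algebra passes between them (`finite_tjurina_iff_of_algEquiv`), so `Isol (step i τ c)` follows.

## Statement

For `F ∈ κ⟦X₁,…,X_m⟧` let `T(F) = (F) + (∂F/∂X_i : i)` (Tjurina ideal). For a `κ`-algebra automorphism `θ` and a
unit `w`: `T(w · θF) = θ(T(F))` (`tjurina_smul_algEquiv_eq_map`), so `κ⟦X⟧/T(w·θF) ≅ κ⟦X⟧/T(F)` as `κ`-algebras and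
one is finite over `κ` iff the other is. (Index type `Fin m`, as the tree's chain rule; the transport to
`Option (Fin n)` by renaming is a separate bookkeeping step.)

References: G.-M. Greuel, C. Lossen, E. Shustin, *Introduction to Singularities and Deformations* (2007), §I.2.1 (the
Tjurina algebra is an invariant of the contact class). [folklore]
-/

noncomputable section

-- single-problem summit: the doubled namespace component `ResolutionOfSingularities` is forced
set_option linter.dupNamespace false

open scoped BigOperators Classical
open MvPowerSeries IsLocalRing

namespace Summit.ResolutionOfSingularities.ResolutionOfSingularities.Theorems

namespace CampaignW46.AtomGerm

open Literature.RingTheory.MvPowerSeries (pd pd_mul pd_subst)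
open Literature.RingTheory.MvPowerSeries.Jets (algHom_apply_eq_subst constantCoeff_algHom_X hasSubst_algHom_X)

variable {κ : Type} [Field κ] {m : ℕ}

/-- **One inclusion**: `T(w · θF) ⊆ θ(T(F))` for any `w` and any `κ`-algebra ENDOmorphism `θ` (Leibniz + chain rule).
[folklore] -/
theorem tjurina_smul_algHom_le_map (θ : MvPowerSeries (Fin m) κ →ₐ[κ] MvPowerSeries (Fin m) κ)
    (F w : MvPowerSeries (Fin m) κ) :
    Ideal.span {w * θ F} ⊔ Ideal.span (Set.range fun j : Fin m => pd j (w * θ F)) ≤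
      (Ideal.span {F} ⊔ Ideal.span (Set.range fun i : Fin m => pd i F)).map (θ : _ →+* MvPowerSeries (Fin m) κ) := by
  have hF : θ F ∈ (Ideal.span {F} ⊔ Ideal.span (Set.range fun i : Fin m => pd i F)).map
      (θ : _ →+* MvPowerSeries (Fin m) κ) :=
    Ideal.mem_map_of_mem _ (Ideal.mem_sup_left (Ideal.subset_span rfl))
  have hdF : ∀ i, θ (pd i F) ∈ (Ideal.span {F} ⊔ Ideal.span (Set.range fun i : Fin m => pd i F)).map
      (θ : _ →+* MvPowerSeries (Fin m) κ) := fun i =>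
    Ideal.mem_map_of_mem _ (Ideal.mem_sup_right (Ideal.subset_span ⟨i, rfl⟩))
  refine sup_le ?_ ?_
  · rw [Ideal.span_singleton_le_iff_mem]
    exact Ideal.mul_mem_left _ _ hF
  · rw [Ideal.span_le]
    rintro _ ⟨j, rfl⟩
    rw [SetLike.mem_coe]
    dsimp only
    rw [pd_mul]
    refine Ideal.add_mem _ (Ideal.mul_mem_left _ _ hF) (Ideal.mul_mem_left _ _ ?_)
    -- chain rule: `∂ⱼ(θF) = Σᵢ θ(∂ᵢF) · ∂ⱼ(θ Xᵢ)`
    rw [algHom_apply_eq_subst θ F, pd_subst (fun s => θ (X s)) (constantCoeff_algHom_X θ) F j]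
    refine Ideal.sum_mem _ fun i _ => Ideal.mul_mem_right _ _ ?_
    rw [← algHom_apply_eq_subst θ (pd i F)]
    exact hdF i

/-- [OURS · L1 W4.6 — DICTIONARY, Isol is intrinsic; NOT a statement of the manuscript] **`T(w · θF) = θ(T(F))`** for a
unit `w` and a `κ`-algebra automorphism `θ` of `κ⟦X₁,…,X_m⟧`. [folklore] -/
theorem tjurina_smul_algEquiv_eq_map (θ : MvPowerSeries (Fin m) κ ≃ₐ[κ] MvPowerSeries (Fin m) κ)
    (F w : MvPowerSeries (Fin m) κ) (hw : IsUnit w) :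
    Ideal.span {w * θ F} ⊔ Ideal.span (Set.range fun j : Fin m => pd j (w * θ F)) =
      (Ideal.span {F} ⊔ Ideal.span (Set.range fun i : Fin m => pd i F)).map
        (θ : MvPowerSeries (Fin m) κ →+* MvPowerSeries (Fin m) κ) := by
  refine le_antisymm (tjurina_smul_algHom_le_map θ.toAlgHom F w) ?_
  -- the other inclusion: apply the first to `θ⁻¹`, `G = w θF`, `w⁻¹`: `F = θ⁻¹(w⁻¹) · θ⁻¹ G`
  obtain ⟨u, rfl⟩ := hw
  set G := (u : MvPowerSeries (Fin m) κ) * θ F with hG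
  have hFG : F = θ.symm ↑u⁻¹ * θ.symm.toAlgHom G := by
    change F = θ.symm ↑u⁻¹ * θ.symm G
    rw [hG, map_mul, ← mul_assoc, ← map_mul, Units.inv_mul, map_one, one_mul, AlgEquiv.symm_apply_apply]
  have h := tjurina_smul_algHom_le_map θ.symm.toAlgHom G (θ.symm ↑u⁻¹)
  rw [← hFG] at h
  -- transport along `θ`
  have h2 := Ideal.map_mono (f := (θ : MvPowerSeries (Fin m) κ →+* MvPowerSeries (Fin m) κ)) h
  rw [Ideal.map_map] at h2
  have hcomp : (θ : MvPowerSeries (Fin m) κ →+* MvPowerSeries (Fin m) κ).comp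
      (θ.symm.toAlgHom : MvPowerSeries (Fin m) κ →+* MvPowerSeries (Fin m) κ) = RingHom.id _ := by
    ext x
    simp
  rw [hcomp, Ideal.map_id] at h2
  exact h2

/-- [OURS · L1 W4.6 — DICTIONARY, Isol is intrinsic; NOT a statement of the manuscript] **The Tjurina algebras of `F`
and `w · θF` are isomorphic**, hence `κ⟦X⟧/T(w·θF)` is finite over `κ` iff `κ⟦X⟧/T(F)` is.
(Greuel–Lossen–Shustin 2007, §I.2.1: the Tjurina algebra is a contact invariant.) [folklore] -/
theorem finite_tjurina_iff_of_algEquiv (θ : MvPowerSeries (Fin m) κ ≃ₐ[κ] MvPowerSeries (Fin m) κ)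
    (F w : MvPowerSeries (Fin m) κ) (hw : IsUnit w) :
    Module.Finite κ (MvPowerSeries (Fin m) κ ⧸
        (Ideal.span {w * θ F} ⊔ Ideal.span (Set.range fun j : Fin m => pd j (w * θ F)))) ↔
      Module.Finite κ (MvPowerSeries (Fin m) κ ⧸
        (Ideal.span {F} ⊔ Ideal.span (Set.range fun i : Fin m => pd i F))) := by
  have e := Ideal.quotientEquivAlg (Ideal.span {F} ⊔ Ideal.span (Set.range fun i : Fin m => pd i F))
    (Ideal.span {w * θ F} ⊔ Ideal.span (Set.range fun j : Fin m => pd j (w * θ F))) θ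
    (tjurina_smul_algEquiv_eq_map θ F w hw)
  exact ⟨fun h => Module.Finite.equiv e.symm.toLinearEquiv, fun h => Module.Finite.equiv e.toLinearEquiv⟩

end CampaignW46.AtomGerm

end Summit.ResolutionOfSingularities.ResolutionOfSingularities.Theorems

end
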